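import Mathlib.AlgebraicGeometry.EllipticCurve.Affine.Point
import Mathlib.NumberTheory.NumberField.Basic
import Mathlib.NumberTheory.Padics.HeightOneSpectrum
import Mathlib.NumberTheory.Padics.RingHoms
import Mathlib.GroupTheory.OrderOfElement
import Mathlib.RingTheory.Coprime.Lemmas
import HarnessLib

/-!
# Route `ByReductionTypeAtTwo` (rung K4), crux `SupersingularRankZeroAtTwo` (item stmt-BirchSwinnertonDyer-19097), line
# `odd_blind_package`, slot 5 CDC_H, binder (hglob)/(P2) of the position glue (★★ p816472): **KUMMER-LINE TOOLS** — the two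
# elementary inputs of the instantiation of the position core (★ p816628) at `C = Kum_J(E)_v`:
# (§1) the two models `E(ℚ_v) ≃ E(ℚ_p)` of the local points, compatibly with base change from `ℚ`;
# (§2) the algebra of a normalised functional `λ : A ↠ ℤ_p` killing exactly the torsion on a group `A` with `A[p] = 0`
# (`A = E(ℚ_p)`, `λ = log_ω`): every `a` is `m • Q₁ + p^J • b` with `m ∈ ℤ`, `m ≡ λ(a) (mod p^J)`, `λ(Q₁) = 1`; and `a ∈ p^J A ↔ p^J ∣ λ(a)`.
# (cell `bsd-2adic`, LEAD ss-1 GEN 21; memo `HOME/ss/gen21/HAND-TARGETS-CDC-4.md` ADDENDUM 4c)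

HONEST FRAMING: THEOREMS ONLY, Mathlib-only imports (no definition, no named fact, no `sorry`); helpers toward (hglob). With the local Kummer
sequence (`ker_localKummerMap = p^J E(ℚ_v)`, `range_localKummerMap = Kum_J`, tree `LocalKummerMap.lean`) §2 says: `Kum_J(E)_v` is cyclic of order
`p^J` generated by `κ_v(Q₁)` and `κ_v(P) = m • κ_v(Q₁)` with `m ≡ λ(P) (mod p^J)` — the «line structure of the Kummer condition at `p`» used by the
position count. Nothing is booked; 19097 stays OPEN; BSD is proved for no curve. bears_on: K4 (19097).
References: [SilvermanAEC2009] VII.6.3, VIII.§2; [MilneADT2006] I Lemma 3.3.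
-/

set_option autoImplicit false
set_option linter.dupNamespace false

noncomputable section

open scoped Classical NumberField

namespace Summit.BirchSwinnertonDyer.BirchSwinnertonDyer.Theorems

namespace OddBlindLocal

open NumberField IsDedekindDomain WeierstrassCurve Rat.HeightOneSpectrum

/-! ## §1 The two models of the `p`-adic points of `E/ℚ` -/

/-- A finite place `v ∋ p` of `ℚ` is the place of `p` (`primesEquiv v = p`). [folklore] -/
private theorem coe_primesEquiv_eq_of_natCast_mem' {p : ℕ} [hp : Fact p.Prime] {v : HeightOneSpectrum (𝓞 ℚ)}
    (hpv : (p : 𝓞 ℚ) ∈ v.asIdeal) : ((primesEquiv v : Nat.Primes) : ℕ) = p := by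
  have h : natGenerator v ∣ p := by
    rw [natGenerator_dvd_iff, ← map_natCast (Rat.IsIntegralClosure.intEquiv (𝓞 ℚ)) p]
    exact Ideal.mem_map_of_mem _ hpv
  exact (Nat.prime_dvd_prime_iff_eq (prime_natGenerator v) hp.out).mp h

/-- Base change of points along the identity `ℚ`-algebra map is the identity. [folklore] -/
private theorem map_algHom_id_eq (E : WeierstrassCurve ℚ) {F : Type*} [Field F] [Algebra ℚ F]
    (Q : (E.baseChange F).toAffine.Point) : Affine.Point.map (AlgHom.id ℚ F) Q = Q := by
  cases Q <;> rfl

/-- **The two models of `E(ℚ_p)` agree, compatibly with base change from `ℚ`**: for `E/ℚ` and the finite place `v ∋ p` there is an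
isomorphism of groups `E(ℚ_v) ≃ E(ℚ_p)` (`ℚ_v = v.adicCompletion ℚ`, `ℚ_p =` Mathlib's `ℚ_[p]`; transport of coordinates along
`Rat.HeightOneSpectrum.adicCompletion.padicEquiv v`) carrying `P ⊗ ℚ_v` to `P ⊗ ℚ_p` for every `P ∈ E(ℚ)`. [folklore]
[cite: SilvermanAEC2009, VII.6.3 (the group `E(K_v)`)] -/
theorem exists_pointAddEquiv_adicCompletion_padic_baseChange (E : WeierstrassCurve ℚ) {p : ℕ} [Fact p.Prime]
    {v : HeightOneSpectrum (𝓞 ℚ)} (hpv : (p : 𝓞 ℚ) ∈ v.asIdeal) :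
    ∃ e : (E.baseChange (v.adicCompletion ℚ)).toAffine.Point ≃+ (E.baseChange ℚ_[p]).toAffine.Point,
      ∀ P : E.toAffine.Point,
        e (Affine.Point.baseChange (W' := E) ℚ (v.adicCompletion ℚ) P) = Affine.Point.baseChange (W' := E) ℚ ℚ_[p] P := by
  obtain rfl : ((primesEquiv v : Nat.Primes) : ℕ) = p := coe_primesEquiv_eq_of_natCast_mem' hpv
  let f : v.adicCompletion ℚ ≃ₐ[ℚ] ℚ_[(primesEquiv v : ℕ)] := (adicCompletion.padicEquiv v).toAlgEquiv
  have hbij : Function.Bijective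
      (Affine.Point.map (W' := E) (f : v.adicCompletion ℚ →ₐ[ℚ] ℚ_[(primesEquiv v : ℕ)])) := by
    refine ⟨Affine.Point.map_injective (W' := E) _, fun Q ↦ ⟨Affine.Point.map (W' := E)
      (f.symm : ℚ_[(primesEquiv v : ℕ)] →ₐ[ℚ] v.adicCompletion ℚ) Q, ?_⟩⟩
    rw [Affine.Point.map_map, AlgEquiv.comp_symm, map_algHom_id_eq]
  refine ⟨AddEquiv.ofBijective _ hbij, fun P ↦ ?_⟩
  rw [AddEquiv.ofBijective_apply]
  exact Affine.Point.map_baseChange (W' := E) (f : v.adicCompletion ℚ →ₐ[ℚ] ℚ_[(primesEquiv v : ℕ)]) P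

/-! ## §2 The algebra of a normalised functional `λ : A ↠ ℤ_p` with `ker λ = A_tors` and `A[p] = 0` -/

section Functional

variable {A : Type*} [AddCommGroup A] {p : ℕ} [hp : Fact p.Prime]

omit hp in
/-- No `p`-torsion ⟹ no `p^k`-torsion. [folklore] -/
theorem eq_zero_of_prime_pow_nsmul_eq_zero (h0 : ∀ a : A, p • a = 0 → a = 0) :
    ∀ (k : ℕ) (a : A), p ^ k • a = 0 → a = 0 := by
  intro k
  induction k with
  | zero => intro a ha; rwa [pow_zero, one_smul] at ha
  | succ k ih => intro a ha; rw [pow_succ, mul_smul] at ha; exact h0 a (ih _ ha)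

/-- In a group without `p`-torsion every torsion element is `p^J`-divisible (its order is prime to `p`). [folklore] -/
theorem exists_eq_prime_pow_nsmul_of_isOfFinAddOrder (h0 : ∀ a : A, p • a = 0 → a = 0) {t : A}
    (ht : IsOfFinAddOrder t) (J : ℕ) : ∃ b : A, t = p ^ J • b := by
  set N := addOrderOf t with hN
  have hN0 : 0 < N := ht.addOrderOf_pos
  -- `p ∤ N`
  have hcop : Nat.Coprime p N := by
    rw [Nat.Prime.coprime_iff_not_dvd hp.out]
    rintro ⟨M, hM⟩
    have hM0 : M ≠ 0 := by rintro rfl; rw [mul_zero] at hM; omega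
    have hMt : M • t = 0 := h0 _ (by rw [← mul_smul, ← hM, hN, addOrderOf_nsmul_eq_zero])
    have hlt : M < N := by
      rw [hM]
      exact lt_mul_left (Nat.pos_of_ne_zero hM0) hp.out.one_lt
    exact nsmul_ne_zero_of_lt_addOrderOf hM0 (hN ▸ hlt) hMt
  -- Bézout: `u p^J + w N = 1`
  have hcopJ : IsCoprime ((p ^ J : ℕ) : ℤ) (N : ℤ) :=
    Nat.isCoprime_iff_coprime.mpr (Nat.Coprime.pow_left J hcop)
  obtain ⟨u, w, huw⟩ := hcopJ
  refine ⟨u • t, ?_⟩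
  calc t = (1 : ℤ) • t := (one_zsmul t).symm
    _ = (u * (p ^ J : ℕ) + w * N) • t := by rw [huw]
    _ = p ^ J • u • t + w • (N • t) := by
        rw [add_zsmul, mul_comm u, mul_zsmul, natCast_zsmul, mul_zsmul, natCast_zsmul]
    _ = p ^ J • u • t := by rw [hN, addOrderOf_nsmul_eq_zero, zsmul_zero, add_zero]

variable (lam : A →+ ℤ_[p]) (hlam : ∀ a : A, lam a = 0 ↔ IsOfFinAddOrder a) (hsurj : Function.Surjective lam)
  (h0 : ∀ a : A, p • a = 0 → a = 0)
include hlam hsurj h0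

/-- **`a ∈ p^J A ↔ p^J ∣ λ(a)`** (for `λ : A ↠ ℤ_p` with `ker λ = A_tors` and `A[p] = 0`). [folklore] -/
theorem exists_eq_prime_pow_nsmul_iff_dvd (J : ℕ) (a : A) :
    (∃ b : A, a = p ^ J • b) ↔ (p : ℤ_[p]) ^ J ∣ lam a := by
  constructor
  · rintro ⟨b, rfl⟩
    exact ⟨lam b, by rw [map_nsmul, nsmul_eq_mul, Nat.cast_pow]⟩
  · rintro ⟨β, hβ⟩
    obtain ⟨Y, rfl⟩ := hsurj β
    have ht : IsOfFinAddOrder (a - p ^ J • Y) := by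
      rw [← hlam, map_sub, map_nsmul, hβ, nsmul_eq_mul, Nat.cast_pow, sub_self]
    obtain ⟨b₀, hb₀⟩ := exists_eq_prime_pow_nsmul_of_isOfFinAddOrder h0 ht J
    exact ⟨Y + b₀, by rw [smul_add, ← hb₀, add_sub_cancel]⟩

/-- **Every `a` is `m • Q₁` modulo `p^J A` with `m ∈ ℤ`, `m ≡ λ(a) (mod p^J)`**, for any `Q₁` with `λ(Q₁) = 1`: `A/p^J A` is cyclic of
order `p^J` generated by `Q₁` (`A = E(ℚ_p)`: Silverman VII.6.3 read through `λ = log_ω`). [cite: SilvermanAEC2009, VII.6.3] -/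
theorem exists_int_sub_zsmul_eq_prime_pow_nsmul (Q₁ : A) (hQ₁ : lam Q₁ = 1) (J : ℕ) (a : A) :
    ∃ (m : ℤ) (b : A), a - m • Q₁ = p ^ J • b ∧ (p : ℤ_[p]) ^ J ∣ lam a - m := by
  refine ⟨((lam a).appr J : ℤ), ?_⟩
  have hm : (p : ℤ_[p]) ^ J ∣ lam a - (((lam a).appr J : ℤ) : ℤ_[p]) := by
    rw [← Ideal.mem_span_singleton, Int.cast_natCast]
    exact PadicInt.appr_spec J (lam a)
  have hm' : (p : ℤ_[p]) ^ J ∣ lam (a - ((lam a).appr J : ℤ) • Q₁) := by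
    rwa [map_sub, map_zsmul, hQ₁, zsmul_eq_mul, mul_one]
  obtain ⟨b, hb⟩ := (exists_eq_prime_pow_nsmul_iff_dvd lam hlam hsurj h0 J _).mpr hm'
  exact ⟨b, hb, hm⟩

/-- **The order of `Q₁` modulo `p^J A` is `p^J`**: `m • Q₁ ∈ p^J A ↔ p^J ∣ m`. [folklore] -/
theorem zsmul_mem_prime_pow_nsmul_iff (Q₁ : A) (hQ₁ : lam Q₁ = 1) (J : ℕ) (m : ℤ) :
    (∃ b : A, m • Q₁ = p ^ J • b) ↔ ((p ^ J : ℕ) : ℤ) ∣ m := by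
  rw [exists_eq_prime_pow_nsmul_iff_dvd lam hlam hsurj h0 J, map_zsmul, hQ₁, zsmul_eq_mul, mul_one]
  constructor
  · rintro ⟨c, hc⟩
    -- `p^J ∣ m` in `ℤ_p` ⟹ in `ℤ` (compare `p`-adic valuations / norms)
    have h := (PadicInt.norm_int_le_pow_iff_dvd (p := p) (k := m) (n := J)).mp (by
      rw [PadicInt.norm_le_pow_iff_mem_span_pow]
      exact Ideal.mem_span_singleton'.mpr ⟨c, by rw [hc, mul_comm]⟩)
    exact_mod_cast h
  · rintro ⟨c, rfl⟩
    exact ⟨c, by push_cast; ring⟩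

end Functional

end OddBlindLocal

end Summit.BirchSwinnertonDyer.BirchSwinnertonDyer.Theorems
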